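/-
COR-CM (cells pub-hodgecm / pub-hodgecm2, Hodge ladder stage 2) — TRANSPOSITION item (vi), sub-binder S2 `supply`
(hodge-director/ITEM6-SPLIT.md §(c′) (vi-2) / §5): the SHIMURA–ALBANESE side (C0/C6a) of the object match — the part of it
that is CATEGORY THEORY of complex abelian varieties, as KERNEL THEOREMS, in the vocabulary of the universe of record.
Written by the stage-1 binder seat pub-hodgecm-mc-binder-2 (gen 22, prover-pub-hodgecm-mc-binder-2-g22-0) in its own
count-neutral lane (theorems only: no definition, no instance, no named fact, nothing asserted; nothing under `CorCM/B01/`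
or `CorCM/B01/Transposition/` is edited or restated).  Twin of binder-1's CM-side files `CorCM/CMSideReachTransfer.lean`
(p279849) / `CorCM/CMSideReachOfInverseType.lean` (p283674).  HC_CM is NOT proved.
-/
import Summits.HodgeConjecture.CorCM.CMSideReachOfInverseType
import HarnessLib

/-!
# The Albanese side of the S2 object match: reaching a tower Albanese variety through products, isogenies, level change

Context.  In own-htheta's PINNED as-printed junction for item (vi) (`Transposition/Item6SupplyPinned.lean`, staged
2026-08-21T15:26Z; ITEM6-SPLIT §(c′) (vi-2) MATCH-SPLIT) the residual binder `hMatch` of the S2 junction is split along a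
pin `Aμ D_μ : AbelianVariety ℂ` (intended `A_μ ⊗_{E,ι₁} ℂ`) into a CM side `hCM` — closed BY NAME by binder-1's
`Model.exists_hom_cmAV_ne_zero_of_forall_mem_iff` — and a SHIMURA–ALBANESE side

  `hReach`: «a non-zero `φ ∈ Hom_E(A_K, A_μ)_ℚ` at an open compact `K` yields, at SOME level `Γ` of the tree's `V`-tower and
  for some Albanese datum `𝒥` of `P_Γ(V)`, a non-zero `𝒥.J ⟶ Aμ D_μ`»,

read in [Liu2021] §4.2 (`A_K := Alb X_K`, the projective system along the generically finite dominant `u^{K'}_K`) and App. C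
Prop. C.5 / l. 4575–4599 (`X_K ⊗_{E,ι₁} ℂ = ⊔_g Γ_g\𝔹²`, `Γ_g = U(V)(F) ∩ gKg⁻¹`) together with three pieces of abelian-variety
algebra: (a) the Albanese variety of a finite disjoint union is the PRODUCT of the Albanese varieties of the pieces, (b) a
generically finite dominant `u : X' → X` of degree `d` gives `u_* ∘ u^* = [d]` on Albanese varieties (so `Alb X` is an
ISOGENY FACTOR of `Alb X'`; level change `K' ≤ K`), (c) base change `Hom_E(A_K, A_μ)_ℚ ↪ ℚ ⊗ Hom(A_K ⊗_{E,ι₁} ℂ, A_μ ⊗_{E,ι₁} ℂ)`.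
This file proves, for ARBITRARY data, everything in `hReach` that is downstream of those identifications:

* §1 (categorical, `AbelianVariety ℂ`; SOURCE-side twins of binder-1's target-side lemmas): a non-zero `φ : A ⟶ B` stays
  non-zero after PRE-composition with a `[N]`-split surjection (`comp_ne_zero_of_split`, `s ≫ p = N • 𝟙 A`, `N ≠ 0`: Hom is
  torsion-free, tree theorem `AbelianVariety.hom_eq_zero_of_nsmul_eq_zero`), with an isogeny INTO `A` (`comp_ne_zero_of_isIsogeny`,
  quasi-inverse `IsIsogeny.exists_nsmul_inverse_holds`), with an epimorphism (`comp_ne_zero_of_epi`); and `A` passes non-zero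
  homomorphisms to anything it is an isogeny factor of (`exists_hom_ne_zero_of_avDominatedBy'`, `Domination.AVDominatedBy A P`)
  or isogenous to in either direction (`exists_hom_ne_zero_of_isIsogeny_to` / `_from`).  Combined with binder-1's
  `CMReach.exists_inj_comp_ne_zero` (a non-zero homomorphism OUT OF a finite product fan is non-zero on a factor):
  `exists_factor_hom_ne_zero_of_…` — out of a finite product `P = ∏_j X_j` reaching `A` by an isomorphism, an isogeny (either
  direction), an epimorphism or a `[N]`-splitting, every non-zero `A ⟶ B` yields a factor `j` and a non-zero `X_j ⟶ B`.
* §2 (universe of record `Model.picardCMUniverse`): with the factors `X_j := (𝒥 j).J` the Albanese varieties of finitely many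
  levels `P_{Γ_j}(V)` of ONE `V`-tower, the conclusions are re-packaged as the CONSEQUENT of `hReach` verbatim,
  `∃ (Γ : Level V) (𝒥 : Jacobian (P_Γ(V))) (w : 𝒥.J ⟶ B), w ≠ 0` (`Model.exists_level_hom_ne_zero_of_fan` and its `_of_iso` /
  `_of_isIsogeny` / `_of_isIsogeny'` / `_of_epi` / `_of_avDominatedBy` / `_of_tmul_…` forms, the last taking the datum as a non-zero element
  of `ℚ ⊗ Hom(A, B)` via binder-1's `Model.exists_ne_zero_of_tmul_ne_zero`).
* §3 SCHEMA `Model.reach_of_albanesePin`: for abstract carriers `Hom K D` (intended `Hom_E(A_K, A_μ)_ℚ`), a second pin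
  `AK K : AbelianVariety ℂ` (intended `A_K ⊗_{E,ι₁} ℂ`), (U1) a map `Hom K D → ℚ ⊗ Hom(AK K, Aμ D)` sending non-zero to non-zero
  on the good `K`, and (U3) for every good `K` a finite product fan of tower Albanese varieties of which `AK K` is an isogeny
  factor — the `hReach` clause follows for every good `K`, every `D`, every non-zero `φ`.  So at a doubly pinned datum the
  Shimura side of S2 is a DERIVATION from two OBJECT IDENTIFICATIONS (U1) + (U3), uniform in `[F:ℚ]` and in the face,
  with no degree / Galois / signature input; nothing automorphic and nothing of B01-S is discharged here.

USE (for the junction owner; nothing here is wired): instantiate §3 with `Lvl := Subgroup (D …).G`, `good := IsOpenCompact`,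
`Hom := (D …).HomK`, or call §2 directly after producing the fan.  HC_CM is NOT proved.

References: D. Mumford, *Abelian Varieties* (1970) §19 (Thm. 1 Cor. 1 p. 173, Remark p. 169, Thm. 3 p. 176);
Y. Liu, *Fourier–Jacobi cycles and arithmetic relative trace formula*, Camb. J. Math. 9 (2021) = arXiv:2102.11518, §4.2
(`FJcycle.tex` l. 2053–2076), App. C (l. 4566–4637); V. K. Murty, D. Ramakrishnan, *The Albanese of unitary Shimura
varieties*, in: The zeta functions of Picard modular surfaces (1992).
-/

noncomputable section

open CategoryTheory CategoryTheory.Limits AlgebraicGeometry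
open Literature.AlgebraicGeometry.Motives
open Literature.AlgebraicGeometry.HodgeTheory
open Literature.NumberTheory.Automorphic.PicardCM

namespace Summit.HodgeConjecture.CorCM

namespace AlbReach

/-! ## §1 Non-zero homomorphisms of complex abelian varieties survive surjections, isogenies and products on the SOURCE side -/

section Categorical

variable {P A B : AbelianVariety ℂ}

/-- **A `[N]`-split surjection kills no non-zero homomorphism**: if `s ≫ p = N • 𝟙 A` with `N ≠ 0` (e.g. `u^* ≫ u_* = [deg u]`
on Albanese varieties for a generically finite dominant `u`, or a quasi-inverse pair of an isogeny) then `φ ≠ 0 ⇒ p ≫ φ ≠ 0`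
(`N • φ = s ≫ (p ≫ φ)` and `Hom(A, B)` is torsion-free — tree theorem `AbelianVariety.hom_eq_zero_of_nsmul_eq_zero`).
[cite: MumfordAV1970, §19 Thm. 3 (p. 176) and Remark p. 169] -/
theorem comp_ne_zero_of_split {s : A ⟶ P} {p : P ⟶ A} {N : ℕ} (hN : N ≠ 0) (hsp : s ≫ p = N • 𝟙 A)
    {φ : A ⟶ B} (hφ : φ ≠ 0) : p ≫ φ ≠ 0 := by
  intro h0
  apply hφ
  refine AbelianVariety.hom_eq_zero_of_nsmul_eq_zero hN ?_
  calc N • φ = (s ≫ p) ≫ φ := by rw [hsp, Preadditive.nsmul_comp, Category.id_comp]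
    _ = 0 := by rw [Category.assoc, h0, comp_zero]

/-- **Isogenies INTO the source kill no non-zero homomorphism**: for an isogeny `p : P ⟶ A` and `φ : A ⟶ B`,
`φ ≠ 0 ⇒ p ≫ φ ≠ 0` (a quasi-inverse `g` with `g ≫ p = [n]_A`, `n ≥ 1`: tree theorem `IsIsogeny.exists_nsmul_inverse_holds`).
[cite: MumfordAV1970, §19 Remark p. 169] -/
theorem comp_ne_zero_of_isIsogeny {p : P ⟶ A} (hp : AbelianVariety.IsIsogeny p) {φ : A ⟶ B} (hφ : φ ≠ 0) :
    p ≫ φ ≠ 0 := by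
  obtain ⟨g, n, hn, -, hgp⟩ := AbelianVariety.IsIsogeny.exists_nsmul_inverse_holds hp
  exact comp_ne_zero_of_split hn.ne' hgp hφ

/-- **Epimorphisms kill no non-zero homomorphism**: `φ ≠ 0 ⇒ p ≫ φ ≠ 0` for an epimorphism `p` of `AbelianVariety ℂ`. [folklore] -/
theorem comp_ne_zero_of_epi (p : P ⟶ A) [Epi p] {φ : A ⟶ B} (hφ : φ ≠ 0) : p ≫ φ ≠ 0 :=
  fun h => hφ ((cancel_epi p).1 (by rw [h, comp_zero]))

/-- **An isogeny factor passes its non-zero homomorphisms up**: if `A` is dominated by `P` (`Domination.AVDominatedBy A P`: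
`s ≫ p = [N]_A`, `N ≠ 0` — `A` an isogeny factor of `P`) then every non-zero `φ : A ⟶ B` gives the non-zero `p ≫ φ : P ⟶ B`
(the source-side twin of `CMReach.exists_hom_ne_zero_of_avDominatedBy`). [cite: MumfordAV1970, §19 Thm. 3 (p. 176) and Remark p. 169] -/
theorem exists_hom_ne_zero_of_avDominatedBy' (h : Domination.AVDominatedBy A P) {φ : A ⟶ B} (hφ : φ ≠ 0) :
    ∃ v : P ⟶ B, v ≠ 0 := by
  obtain ⟨s, p, N, hN, hsp⟩ := h
  exact ⟨p ≫ φ, comp_ne_zero_of_split hN hsp hφ⟩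

/-- **Isogenous sources, isogeny `P ⟶ A`**: every non-zero `φ : A ⟶ B` gives a non-zero `P ⟶ B`.
[cite: MumfordAV1970, §19 Remark p. 169] -/
theorem exists_hom_ne_zero_of_isIsogeny_to {p : P ⟶ A} (hp : AbelianVariety.IsIsogeny p) {φ : A ⟶ B} (hφ : φ ≠ 0) :
    ∃ v : P ⟶ B, v ≠ 0 :=
  ⟨p ≫ φ, comp_ne_zero_of_isIsogeny hp hφ⟩

/-- **Isogenous sources, isogeny `A ⟶ P`**: every non-zero `φ : A ⟶ B` gives a non-zero `P ⟶ B` (pre-compose `φ` with a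
quasi-inverse `g : P ⟶ A`, `q ≫ g = [n]_A`). [cite: MumfordAV1970, §19 Remark p. 169] -/
theorem exists_hom_ne_zero_of_isIsogeny_from {q : A ⟶ P} (hq : AbelianVariety.IsIsogeny q) {φ : A ⟶ B} (hφ : φ ≠ 0) :
    ∃ v : P ⟶ B, v ≠ 0 := by
  obtain ⟨g, n, hn, hqg, -⟩ := AbelianVariety.IsIsogeny.exists_nsmul_inverse_holds hq
  exact ⟨g ≫ φ, comp_ne_zero_of_split hn.ne' hqg hφ⟩

/-- **Isogenous sources, either direction** (`IsIsogenous P A ∨ IsIsogenous A P`; the tree's `IsIsogenous` is one-directional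
by definition): every non-zero `φ : A ⟶ B` gives a non-zero `P ⟶ B`. [cite: MumfordAV1970, §19 Remark p. 169] -/
theorem exists_hom_ne_zero_of_isIsogenous (h : AbelianVariety.IsIsogenous P A ∨ AbelianVariety.IsIsogenous A P)
    {φ : A ⟶ B} (hφ : φ ≠ 0) : ∃ v : P ⟶ B, v ≠ 0 := by
  rcases h with ⟨p, hp⟩ | ⟨q, hq⟩
  · exact exists_hom_ne_zero_of_isIsogeny_to hp hφ
  · exact exists_hom_ne_zero_of_isIsogeny_from hq hφ

/-! ### Out of a finite product reaching the source (binder-1's `CMReach.exists_inj_comp_ne_zero` on the product side) -/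

variable {J : Type} [Fintype J] [DecidableEq J] {X : J → AbelianVariety ℂ} {π : (j : J) → (P ⟶ X j)}

/-- **Out of a finite product, directly**: if `(P, π_j)_j` is a limit fan of `X : J → AbelianVariety ℂ` and `w : P ⟶ B` is
non-zero then some factor has a non-zero `X j ⟶ B` (binder-1's `CMReach.exists_inj_comp_ne_zero`, forgetting the section).
[cite: MumfordAV1970, §19 Thm. 1 Cor. 1 (p. 173)] -/
theorem exists_factor_hom_ne_zero (hlim : IsLimit (Fan.mk P π)) {w : P ⟶ B} (hw : w ≠ 0) :
    ∃ (j : J) (v : X j ⟶ B), v ≠ 0 := by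
  obtain ⟨j, s, -, hs⟩ := CMReach.exists_inj_comp_ne_zero hlim hw
  exact ⟨j, s ≫ w, hs⟩

/-- **Out of a finite product, through an isogeny `∏_j X_j ⟶ A`** («`A ∼ ∏_j X_j`»): every non-zero `φ : A ⟶ B` yields a
factor `j` and a non-zero `X j ⟶ B`. [cite: MumfordAV1970, §19 Thm. 1 Cor. 1 (p. 173) and Remark p. 169] -/
theorem exists_factor_hom_ne_zero_of_isIsogeny_to (hlim : IsLimit (Fan.mk P π)) {p : P ⟶ A}
    (hp : AbelianVariety.IsIsogeny p) {φ : A ⟶ B} (hφ : φ ≠ 0) : ∃ (j : J) (v : X j ⟶ B), v ≠ 0 :=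
  exists_factor_hom_ne_zero hlim (comp_ne_zero_of_isIsogeny hp hφ)

/-- **Out of a finite product, through an isogeny `A ⟶ ∏_j X_j`**: every non-zero `φ : A ⟶ B` yields a factor `j` and a
non-zero `X j ⟶ B`. [cite: MumfordAV1970, §19 Thm. 1 Cor. 1 (p. 173) and Remark p. 169] -/
theorem exists_factor_hom_ne_zero_of_isIsogeny_from (hlim : IsLimit (Fan.mk P π)) {q : A ⟶ P}
    (hq : AbelianVariety.IsIsogeny q) {φ : A ⟶ B} (hφ : φ ≠ 0) : ∃ (j : J) (v : X j ⟶ B), v ≠ 0 := by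
  obtain ⟨w, hw⟩ := exists_hom_ne_zero_of_isIsogeny_from hq hφ
  exact exists_factor_hom_ne_zero hlim hw

/-- **Out of a finite product of which `A` is an isogeny factor** (`Domination.AVDominatedBy A (∏_j X_j)`: `s ≫ p = [N]_A` —
e.g. `A = Alb X_K`, `∏ = Alb(X_{K'} ⊗ ℂ)` for a neat `K' ≤ K`, `s = u^*`, `p = u_*`, `N = deg u`): every non-zero `φ : A ⟶ B`
yields a factor `j` and a non-zero `X j ⟶ B`. [cite: MumfordAV1970, §19 Thm. 1 Cor. 1 (p. 173) and Thm. 3 (p. 176)] -/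
theorem exists_factor_hom_ne_zero_of_avDominatedBy (hlim : IsLimit (Fan.mk P π)) (h : Domination.AVDominatedBy A P)
    {φ : A ⟶ B} (hφ : φ ≠ 0) : ∃ (j : J) (v : X j ⟶ B), v ≠ 0 := by
  obtain ⟨w, hw⟩ := exists_hom_ne_zero_of_avDominatedBy' h hφ
  exact exists_factor_hom_ne_zero hlim hw

/-- **Out of a finite product, through an epimorphism `∏_j X_j ⟶ A`** of `AbelianVariety ℂ`: every non-zero `φ : A ⟶ B`
yields a factor `j` and a non-zero `X j ⟶ B`. [cite: MumfordAV1970, §19 Thm. 1 Cor. 1 (p. 173)] -/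
theorem exists_factor_hom_ne_zero_of_epi (hlim : IsLimit (Fan.mk P π)) (p : P ⟶ A) [Epi p] {φ : A ⟶ B} (hφ : φ ≠ 0) :
    ∃ (j : J) (v : X j ⟶ B), v ≠ 0 :=
  exists_factor_hom_ne_zero hlim (comp_ne_zero_of_epi p hφ)

/-- **Out of a finite product, behind an isomorphism `A ≅ ∏_j X_j`** (binder-1's `CMReach.exists_comp_ne_zero_of_iso_prod`,
re-exported here so that §2 has all five shapes side by side). [cite: MumfordAV1970, §19 Thm. 1 Cor. 1 (p. 173)] -/
theorem exists_factor_hom_ne_zero_of_iso (hlim : IsLimit (Fan.mk P π)) (e : A ≅ P) {φ : A ⟶ B} (hφ : φ ≠ 0) :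
    ∃ (j : J) (v : X j ⟶ B), v ≠ 0 :=
  CMReach.exists_comp_ne_zero_of_iso_prod hlim e hφ

end Categorical

end AlbReach

/-! ## §2 The universe of record: a finite product of tower Albanese varieties reaching `A` delivers the consequent of `hReach` -/

namespace Model

open AlbReach

section Tower

variable (h₁ : BallQuotientUniformised) (h₃ : CMAbelianVarietyRealised)
  {F : CMField} {ι₁ : F →+* ℂ} {V : HermSpace3 F ι₁}
  {J : Type} [Fintype J] [DecidableEq J] (Γ : J → Level V)
  (𝒥 : ∀ j : J, Jacobian (Var.scheme (ballQuotientUniformisedDatum_of h₁) h₃ (.pms (pmsCode F ι₁ V (Γ j)))))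
  {P A B : AbelianVariety ℂ} {π : (j : J) → (P ⟶ (𝒥 j).J)}

/-- **A finite product of tower Albanese varieties reaches, on some level, whatever it maps to non-trivially**
(`U = picardCMUniverse hHD hI h₁ h₃`): for finitely many levels `Γ_j` of the `V`-tower with Albanese data `𝒥_j` of the realised
Picard modular surfaces `P_{Γ_j}(V)` and a limit fan `(P, π_j : P ⟶ Alb P_{Γ_j}(V))_j` (intended: `P = Alb(X_K ⊗_{E,ι₁} ℂ)`,
`X_K ⊗_{E,ι₁} ℂ = ⊔_j Γ_j\𝔹²`, [Liu2021] App. C l. 4575–4599 + Prop. C.5, Albanese of a disjoint union), every non-zero `w : P ⟶ B`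
gives a level `Γ`, an Albanese datum `𝒥` of `P_Γ(V)` and a non-zero `𝒥.J ⟶ B` — the consequent of own-htheta's `hReach` verbatim.
[cite: Liu2021, App. C Prop. C.5] -/
theorem exists_level_hom_ne_zero_of_fan (hlim : IsLimit (Fan.mk P π)) {w : P ⟶ B} (hw : w ≠ 0) :
    ∃ (Γ₀ : Level V) (𝒥₀ : Jacobian (Var.scheme (ballQuotientUniformisedDatum_of h₁) h₃ (.pms (pmsCode F ι₁ V Γ₀))))
      (u : 𝒥₀.J ⟶ B), u ≠ 0 := by
  obtain ⟨j, v, hv⟩ := exists_factor_hom_ne_zero hlim hw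
  exact ⟨Γ j, 𝒥 j, v, hv⟩

/-- **… behind an isomorphism `A ≅ ∏_j Alb P_{Γ_j}(V)`** (neat `K`: `A_K ⊗_{E,ι₁} ℂ ≅ ∏_g Alb(Γ_g\𝔹²)`): every non-zero
`φ : A ⟶ B` gives `Γ`, `𝒥`, and a non-zero `𝒥.J ⟶ B`. [cite: Liu2021, §4.2 and App. C Prop. C.5] -/
theorem exists_level_hom_ne_zero_of_iso (hlim : IsLimit (Fan.mk P π)) (e : A ≅ P) {φ : A ⟶ B} (hφ : φ ≠ 0) :
    ∃ (Γ₀ : Level V) (𝒥₀ : Jacobian (Var.scheme (ballQuotientUniformisedDatum_of h₁) h₃ (.pms (pmsCode F ι₁ V Γ₀))))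
      (u : 𝒥₀.J ⟶ B), u ≠ 0 := by
  obtain ⟨j, v, hv⟩ := exists_factor_hom_ne_zero_of_iso hlim e hφ
  exact ⟨Γ j, 𝒥 j, v, hv⟩

/-- **… through an isogeny `∏_j Alb P_{Γ_j}(V) ⟶ A`** («`A_K ⊗ ℂ ∼ ∏`»): every non-zero `φ : A ⟶ B` gives `Γ`, `𝒥`, and a
non-zero `𝒥.J ⟶ B`. [cite: Liu2021, §4.2 and App. C Prop. C.5] [cite: MumfordAV1970, §19 Remark p. 169] -/
theorem exists_level_hom_ne_zero_of_isIsogeny (hlim : IsLimit (Fan.mk P π)) {p : P ⟶ A}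
    (hp : AbelianVariety.IsIsogeny p) {φ : A ⟶ B} (hφ : φ ≠ 0) :
    ∃ (Γ₀ : Level V) (𝒥₀ : Jacobian (Var.scheme (ballQuotientUniformisedDatum_of h₁) h₃ (.pms (pmsCode F ι₁ V Γ₀))))
      (u : 𝒥₀.J ⟶ B), u ≠ 0 := by
  obtain ⟨j, v, hv⟩ := exists_factor_hom_ne_zero_of_isIsogeny_to hlim hp hφ
  exact ⟨Γ j, 𝒥 j, v, hv⟩

/-- **… through an isogeny `A ⟶ ∏_j Alb P_{Γ_j}(V)`**: every non-zero `φ : A ⟶ B` gives `Γ`, `𝒥`, and a non-zero `𝒥.J ⟶ B`.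
[cite: Liu2021, §4.2 and App. C Prop. C.5] [cite: MumfordAV1970, §19 Remark p. 169] -/
theorem exists_level_hom_ne_zero_of_isIsogeny' (hlim : IsLimit (Fan.mk P π)) {q : A ⟶ P}
    (hq : AbelianVariety.IsIsogeny q) {φ : A ⟶ B} (hφ : φ ≠ 0) :
    ∃ (Γ₀ : Level V) (𝒥₀ : Jacobian (Var.scheme (ballQuotientUniformisedDatum_of h₁) h₃ (.pms (pmsCode F ι₁ V Γ₀))))
      (u : 𝒥₀.J ⟶ B), u ≠ 0 := by
  obtain ⟨j, v, hv⟩ := exists_factor_hom_ne_zero_of_isIsogeny_from hlim hq hφ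
  exact ⟨Γ j, 𝒥 j, v, hv⟩

/-- **… when `A` is an isogeny factor of `∏_j Alb P_{Γ_j}(V)`** (`Domination.AVDominatedBy A P`, `s ≫ p = [N]_A`: the level
change `K' ≤ K`, `u^* ≫ u_* = [deg u]`, composed with the disjoint-union isomorphism at the neat level `K'`): every non-zero
`φ : A ⟶ B` gives `Γ`, `𝒥`, and a non-zero `𝒥.J ⟶ B`. [cite: Liu2021, §4.2 and App. C Prop. C.5]
[cite: MumfordAV1970, §19 Thm. 3 (p. 176)] -/
theorem exists_level_hom_ne_zero_of_avDominatedBy (hlim : IsLimit (Fan.mk P π)) (h : Domination.AVDominatedBy A P)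
    {φ : A ⟶ B} (hφ : φ ≠ 0) :
    ∃ (Γ₀ : Level V) (𝒥₀ : Jacobian (Var.scheme (ballQuotientUniformisedDatum_of h₁) h₃ (.pms (pmsCode F ι₁ V Γ₀))))
      (u : 𝒥₀.J ⟶ B), u ≠ 0 := by
  obtain ⟨j, v, hv⟩ := exists_factor_hom_ne_zero_of_avDominatedBy hlim h hφ
  exact ⟨Γ j, 𝒥 j, v, hv⟩

/-- **… through an epimorphism `∏_j Alb P_{Γ_j}(V) ⟶ A`** (e.g. a surjective Albanese map known to be epi): every non-zero
`φ : A ⟶ B` gives `Γ`, `𝒥`, and a non-zero `𝒥.J ⟶ B`. [cite: Liu2021, §4.2 and App. C Prop. C.5] -/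
theorem exists_level_hom_ne_zero_of_epi (hlim : IsLimit (Fan.mk P π)) (p : P ⟶ A) [Epi p] {φ : A ⟶ B} (hφ : φ ≠ 0) :
    ∃ (Γ₀ : Level V) (𝒥₀ : Jacobian (Var.scheme (ballQuotientUniformisedDatum_of h₁) h₃ (.pms (pmsCode F ι₁ V Γ₀))))
      (u : 𝒥₀.J ⟶ B), u ≠ 0 := by
  obtain ⟨j, v, hv⟩ := exists_factor_hom_ne_zero_of_epi hlim p hφ
  exact ⟨Γ j, 𝒥 j, v, hv⟩

/-- **… with the datum read in `ℚ ⊗ Hom(A, B)`** (Liu's `Hom_E(A_K, A_μ)_ℚ` after base change to `ℂ`): a non-zero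
`x ∈ ℚ ⊗_ℤ Hom(A, B)` with `A` an isogeny factor of `∏_j Alb P_{Γ_j}(V)` gives `Γ`, `𝒥`, and a non-zero `𝒥.J ⟶ B`
(binder-1's `Model.exists_ne_zero_of_tmul_ne_zero`: `ℚ ⊗ Hom ∋ x ≠ 0 ⇒ Hom ≠ 0`). [cite: Liu2021, §4.2, Thm. 4.18 (1) and App. C Prop. C.5] -/
theorem exists_level_hom_ne_zero_of_tmul_of_avDominatedBy (hlim : IsLimit (Fan.mk P π))
    (h : Domination.AVDominatedBy A P) {x : TensorProduct ℤ ℚ (A ⟶ B)} (hx : x ≠ 0) :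
    ∃ (Γ₀ : Level V) (𝒥₀ : Jacobian (Var.scheme (ballQuotientUniformisedDatum_of h₁) h₃ (.pms (pmsCode F ι₁ V Γ₀))))
      (u : 𝒥₀.J ⟶ B), u ≠ 0 := by
  obtain ⟨φ, hφ⟩ := exists_ne_zero_of_tmul_ne_zero hx
  exact exists_level_hom_ne_zero_of_avDominatedBy h₁ h₃ Γ 𝒥 hlim h hφ

/-- **… with the datum read in `ℚ ⊗ Hom(A, B)`, through an isogeny `∏_j Alb P_{Γ_j}(V) ⟶ A`.**
[cite: Liu2021, §4.2, Thm. 4.18 (1) and App. C Prop. C.5] -/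
theorem exists_level_hom_ne_zero_of_tmul_of_isIsogeny (hlim : IsLimit (Fan.mk P π)) {p : P ⟶ A}
    (hp : AbelianVariety.IsIsogeny p) {x : TensorProduct ℤ ℚ (A ⟶ B)} (hx : x ≠ 0) :
    ∃ (Γ₀ : Level V) (𝒥₀ : Jacobian (Var.scheme (ballQuotientUniformisedDatum_of h₁) h₃ (.pms (pmsCode F ι₁ V Γ₀))))
      (u : 𝒥₀.J ⟶ B), u ≠ 0 := by
  obtain ⟨φ, hφ⟩ := exists_ne_zero_of_tmul_ne_zero hx
  exact exists_level_hom_ne_zero_of_isIsogeny h₁ h₃ Γ 𝒥 hlim hp hφ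

end Tower

/-! ## §3 SCHEMA: `hReach` at a doubly pinned datum is (U1) a Hom carrier + (U3) a tower-product of which `A_K ⊗ ℂ` is an
isogeny factor -/

section Schema

variable (h₁ : BallQuotientUniformised) (h₃ : CMAbelianVarietyRealised)
  {F : CMField} {ι₁ : F →+* ℂ} {V : HermSpace3 F ι₁}

/-- **SCHEMA for `hReach` at a second pin** (`U = picardCMUniverse hHD hI h₁ h₃`; one face context `(F, ι₁, V)` and one CM
type at a time — the outer guards of own-htheta's binder are the caller's).  Abstract carriers: levels `Lvl` (intended
`Subgroup G`, `G = U(V)(𝔸_{F⁺,f})`) with a predicate `good` (intended `IsOpenCompact`), objects `Obj` (intended `𝒜(μ)`), Hom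
groups `Hom K D` with a zero (intended `Hom_E(A_K, A_μ)_ℚ`), and TWO pins `AK K`, `Aμ D : AbelianVariety ℂ` (intended
`A_K ⊗_{E,ι₁} ℂ`, `A_μ ⊗_{E,ι₁} ℂ`).  Hypotheses = the two object identifications that stay POSITED:
* (U1) `carrier` / `hcar` — on good `K`, a non-zero `φ ∈ Hom K D` has a non-zero image in `ℚ ⊗ Hom(AK K, Aμ D)` (base change
  of homomorphisms along `ι₁ : E → ℂ` is injective) [Liu2021 §4.2, Thm. 4.18 (1): the Hom group is `Hom_E(A_K, A_μ)_ℚ`];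
* (U3) `hAlb` — on good `K`, finitely many levels `Γ_j : Level V` with Albanese data and a product fan of the `Alb P_{Γ_j}(V)`
  of which `AK K` is an isogeny factor [Liu2021 App. C l. 4575–4599 + Prop. C.5 (`X_{K'} ⊗_{E,ι₁} ℂ = ⊔_g Γ_g\𝔹²` at a neat
  `K' ≤ K`), Albanese of a disjoint union, `u^* ≫ u_* = [deg u]` for `u = u^{K'}_K`].
Conclusion = own-htheta's `hReach` clause at `(F, ι₁, V, Φ)`: every good `K`, every `D`, every non-zero `φ` reaches some
`Alb P_Γ(V) ⟶ Aμ D` non-trivially.  Uniform in `[F:ℚ]` and in the face.  HC_CM is NOT proved; (U1), (U3) are not inhabited here.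
[cite: Liu2021, §4.2, Thm. 4.18 (1) and App. C Prop. C.5] [cite: MumfordAV1970, §19] -/
theorem reach_of_albanesePin {Lvl Obj : Type} (good : Lvl → Prop) (Hom : Lvl → Obj → Type) [∀ K D, Zero (Hom K D)]
    (AK : Lvl → AbelianVariety ℂ) (Aμ : Obj → AbelianVariety ℂ)
    (carrier : ∀ (K : Lvl) (D : Obj), Hom K D → TensorProduct ℤ ℚ (AK K ⟶ Aμ D))
    (hcar : ∀ (K : Lvl) (D : Obj) (φ : Hom K D), good K → φ ≠ 0 → carrier K D φ ≠ 0)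
    (hAlb : ∀ K : Lvl, good K →
      ∃ (J : Type) (_ : Fintype J) (_ : DecidableEq J) (Γ : J → Level V)
        (𝒥 : ∀ j : J, Jacobian (Var.scheme (ballQuotientUniformisedDatum_of h₁) h₃ (.pms (pmsCode F ι₁ V (Γ j)))))
        (P : AbelianVariety ℂ) (π : (j : J) → (P ⟶ (𝒥 j).J)), Nonempty (IsLimit (Fan.mk P π)) ∧
          Domination.AVDominatedBy (AK K) P) :
    ∀ (K : Lvl) (D : Obj) (φ : Hom K D), good K → φ ≠ 0 →
      ∃ (Γ₀ : Level V) (𝒥₀ : Jacobian (Var.scheme (ballQuotientUniformisedDatum_of h₁) h₃ (.pms (pmsCode F ι₁ V Γ₀))))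
        (w : 𝒥₀.J ⟶ Aμ D), w ≠ 0 := by
  intro K D φ hK hφ
  obtain ⟨J, _, _, Γ, 𝒥, P, π, ⟨hlim⟩, hdom⟩ := hAlb K hK
  exact exists_level_hom_ne_zero_of_tmul_of_avDominatedBy h₁ h₃ Γ 𝒥 hlim hdom (hcar K D φ hK hφ)

/-- **SCHEMA, isogeny form** — (U3) with an isogeny `∏_j Alb P_{Γ_j}(V) ⟶ AK K` instead of a domination (neat `K`:
`A_K ⊗_{E,ι₁} ℂ ≅ ∏_g Alb(Γ_g\𝔹²)` is in particular isogenous to it). [cite: Liu2021, §4.2, Thm. 4.18 (1) and App. C Prop. C.5] -/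
theorem reach_of_albanesePin_isIsogeny {Lvl Obj : Type} (good : Lvl → Prop) (Hom : Lvl → Obj → Type)
    [∀ K D, Zero (Hom K D)] (AK : Lvl → AbelianVariety ℂ) (Aμ : Obj → AbelianVariety ℂ)
    (carrier : ∀ (K : Lvl) (D : Obj), Hom K D → TensorProduct ℤ ℚ (AK K ⟶ Aμ D))
    (hcar : ∀ (K : Lvl) (D : Obj) (φ : Hom K D), good K → φ ≠ 0 → carrier K D φ ≠ 0)
    (hAlb : ∀ K : Lvl, good K →
      ∃ (J : Type) (_ : Fintype J) (_ : DecidableEq J) (Γ : J → Level V)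
        (𝒥 : ∀ j : J, Jacobian (Var.scheme (ballQuotientUniformisedDatum_of h₁) h₃ (.pms (pmsCode F ι₁ V (Γ j)))))
        (P : AbelianVariety ℂ) (π : (j : J) → (P ⟶ (𝒥 j).J)) (p : P ⟶ AK K), Nonempty (IsLimit (Fan.mk P π)) ∧
          AbelianVariety.IsIsogeny p) :
    ∀ (K : Lvl) (D : Obj) (φ : Hom K D), good K → φ ≠ 0 →
      ∃ (Γ₀ : Level V) (𝒥₀ : Jacobian (Var.scheme (ballQuotientUniformisedDatum_of h₁) h₃ (.pms (pmsCode F ι₁ V Γ₀))))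
        (w : 𝒥₀.J ⟶ Aμ D), w ≠ 0 := by
  intro K D φ hK hφ
  obtain ⟨J, _, _, Γ, 𝒥, P, π, p, ⟨hlim⟩, hp⟩ := hAlb K hK
  exact exists_level_hom_ne_zero_of_tmul_of_isIsogeny h₁ h₃ Γ 𝒥 hlim hp (hcar K D φ hK hφ)

end Schema

end Model

end Summit.HodgeConjecture.CorCM

end
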